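import Summits.Ventures.PackingBounds.Configurations.E8Closure
import Summits.Ventures.PackingBounds.Configurations.E8Moments

/-!
# Pair and triple counts in `240`-point kissing configurations of `ℝ⁸` (Bannai–Sloane, step (ii), part 2)

Framing: lottery ticket; floor = certified bounds/negative ranges. Venture `PackingBounds` (cell
`pub-packcert`, seat `pub-packcert-energy`).

Let `C ⊂ S⁷` be any kissing configuration with `|C| = 240` and let `a, b ∈ C` be ORTHOGONAL. From the
polarised fourth moment `Σ_y ⟨a,y⟩²⟨b,y⟩² = 3` (`E8Moments.sum_sq_mul_sq`) and the fact that every summand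
is `0` or `1/16`, exactly `48` points `y ∈ C` have `⟨a,y⟩, ⟨b,y⟩ ∈ {±1/2}`; the antipodal map and the
reflection in `a` (`E8Closure`) permute the four sign classes, so each has exactly `12` points:
`#{y ∈ C : ⟨a,y⟩ = ⟨b,y⟩ = 1/2} = 12` (`card_half_half`) — the number of roots of `E₈` having inner
product `1` with each of two orthogonal roots. From the three-direction moment
`Σ_y ⟨a,y⟩²⟨b,y⟩²⟨c,y⟩² = 1/4` we get, for pairwise orthogonal `a, b, c ∈ C`, a point `y ∈ C` with
`⟨a,y⟩, ⟨b,y⟩, ⟨c,y⟩ ∈ {±1/2}`, hence (flipping signs of `a, b, c` inside the antipodal `C`) an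
orthonormal triple `a', b', c' ∈ C` and `y ∈ C` with `⟨a',y⟩ = ⟨b',y⟩ = ⟨c',y⟩ = 1/2`
(`exists_triple_half`). These are the two counting inputs of the frame construction in `E8Frame.lean`.

## References
* E. Bannai, N. J. A. Sloane, Canad. J. Math. 33 (1981) 437–449 (= Conway–Sloane, *SPLAG*, Ch. 14, Thm. 5 (d)). [`ConwaySloane1999`]
-/

namespace Summit.Ventures.PackingBounds.Config.E8PairCounts

open Finset

section config

variable {C : Finset (EuclideanSpace ℝ (Fin 8))} (h1 : ∀ x ∈ C, ‖x‖ = 1)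
  (h2 : ∀ x ∈ C, ∀ y ∈ C, x ≠ y → inner ℝ x y ≤ 1 / 2) (hcard : C.card = 240)
include h1 h2 hcard

/-- If `a ⊥ b` are points of `C` and `y ∈ C` has `⟨a,y⟩ ≠ 0 ≠ ⟨b,y⟩`, then `⟨a,y⟩ = ±1/2`. -/
theorem inner_eq_half_or {a b y : EuclideanSpace ℝ (Fin 8)} (ha : a ∈ C)
    (hab : inner ℝ a b = 0) (hy : y ∈ C) (hay : inner ℝ a y ≠ 0) (hby : inner ℝ b y ≠ 0) :
    inner ℝ a y = 1 / 2 ∨ inner ℝ a y = -1 / 2 := by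
  rcases E8Closure.inner_cases h1 h2 hcard ha hy with h | h | h | h | h
  · exfalso
    have hya : a = y := E8Closure.eq_of_inner_eq_one (h1 a ha) (h1 y hy) h
    rw [← hya, real_inner_comm, hab] at hby
    exact hby rfl
  · exfalso
    have hya : y = -a := E8Closure.eq_neg_of_inner_eq_neg_one (h1 a ha) (h1 y hy) h
    rw [hya, inner_neg_right, real_inner_comm, hab, neg_zero] at hby
    exact hby rfl
  · exact Or.inr h
  · exact absurd h hay
  · exact Or.inl h

/-- The set of points with both inner products nonzero, w.r.t. an orthogonal pair `a, b ∈ C`, is the union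
of the four sign classes `⟨a,y⟩, ⟨b,y⟩ ∈ {±1/2}`. -/
theorem filter_mul_ne_zero_eq {a b : EuclideanSpace ℝ (Fin 8)} (ha : a ∈ C) (hb : b ∈ C)
    (hab : inner ℝ a b = 0) :
    C.filter (fun y => inner ℝ a y * inner ℝ b y ≠ 0) =
      C.filter (fun y => inner ℝ a y = 1 / 2 ∧ inner ℝ b y = 1 / 2) ∪
      C.filter (fun y => inner ℝ a y = 1 / 2 ∧ inner ℝ b y = -1 / 2) ∪
      C.filter (fun y => inner ℝ a y = -1 / 2 ∧ inner ℝ b y = 1 / 2) ∪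
      C.filter (fun y => inner ℝ a y = -1 / 2 ∧ inner ℝ b y = -1 / 2) := by
  have hba : inner ℝ b a = 0 := by rw [real_inner_comm]; exact hab
  ext y
  simp only [Finset.mem_union, Finset.mem_filter]
  constructor
  · rintro ⟨hy, hne⟩
    have hay : inner ℝ a y ≠ 0 := fun h => hne (by rw [h, zero_mul])
    have hby : inner ℝ b y ≠ 0 := fun h => hne (by rw [h, mul_zero])
    rcases inner_eq_half_or h1 h2 hcard ha hab hy hay hby with h | h <;>
      rcases inner_eq_half_or h1 h2 hcard hb hba hy hby hay with h' | h'
    · exact Or.inl (Or.inl (Or.inl ⟨hy, h, h'⟩))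
    · exact Or.inl (Or.inl (Or.inr ⟨hy, h, h'⟩))
    · exact Or.inl (Or.inr ⟨hy, h, h'⟩)
    · exact Or.inr ⟨hy, h, h'⟩
  · rintro (((⟨hy, h, h'⟩ | ⟨hy, h, h'⟩) | ⟨hy, h, h'⟩) | ⟨hy, h, h'⟩) <;>
      refine ⟨hy, ?_⟩ <;> rw [h, h'] <;> norm_num

/-- `48` points of `C` have both inner products nonzero with an orthogonal pair `a, b ∈ C`. -/
theorem card_filter_mul_ne_zero {a b : EuclideanSpace ℝ (Fin 8)} (ha : a ∈ C) (hb : b ∈ C)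
    (hab : inner ℝ a b = 0) : (C.filter (fun y => inner ℝ a y * inner ℝ b y ≠ 0)).card = 48 := by
  have hba : inner ℝ b a = 0 := by rw [real_inner_comm]; exact hab
  have hS := E8Moments.sum_sq_mul_sq h1 h2 hcard (h1 a ha) (h1 b hb) hab
  have hterm : ∀ y ∈ C, inner ℝ a y ^ 2 * inner ℝ b y ^ 2 =
      if inner ℝ a y * inner ℝ b y ≠ 0 then (1 / 16 : ℝ) else 0 := by
    intro y hy
    split_ifs with hne
    · have hay : inner ℝ a y ≠ 0 := fun h => hne (by rw [h, zero_mul])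
      have hby : inner ℝ b y ≠ 0 := fun h => hne (by rw [h, mul_zero])
      rcases inner_eq_half_or h1 h2 hcard ha hab hy hay hby with h | h <;>
        rcases inner_eq_half_or h1 h2 hcard hb hba hy hby hay with h' | h' <;>
          rw [h, h'] <;> norm_num
    · push Not at hne
      calc inner ℝ a y ^ 2 * inner ℝ b y ^ 2 = (inner ℝ a y * inner ℝ b y) ^ 2 := by ring
        _ = 0 := by rw [hne]; ring
  rw [Finset.sum_congr rfl hterm, Finset.sum_ite, Finset.sum_const_zero, add_zero, Finset.sum_const,
    nsmul_eq_mul] at hS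
  have : ((C.filter (fun y => inner ℝ a y * inner ℝ b y ≠ 0)).card : ℝ) = 48 := by linarith
  exact_mod_cast this

/-- The antipodal map matches the sign classes `(s, t)` and `(-s, -t)`. -/
theorem card_filter_neg {a b : EuclideanSpace ℝ (Fin 8)} (s t : ℝ) :
    (C.filter (fun y => inner ℝ a y = s ∧ inner ℝ b y = t)).card =
      (C.filter (fun y => inner ℝ a y = -s ∧ inner ℝ b y = -t)).card := by
  refine Finset.card_bij' (fun y _ => -y) (fun y _ => -y) ?_ ?_ (fun y _ => neg_neg y) (fun y _ => neg_neg y)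
  · intro y hy
    simp only [Finset.mem_filter] at hy ⊢
    refine ⟨E8Closure.neg_mem h1 h2 hcard hy.1, ?_, ?_⟩
    · rw [inner_neg_right, hy.2.1]
    · rw [inner_neg_right, hy.2.2]
  · intro y hy
    simp only [Finset.mem_filter] at hy ⊢
    refine ⟨E8Closure.neg_mem h1 h2 hcard hy.1, ?_, ?_⟩
    · rw [inner_neg_right, hy.2.1, neg_neg]
    · rw [inner_neg_right, hy.2.2, neg_neg]

/-- The reflection in `a` matches the sign classes `(s, t)` and `(-s, t)` (for `b ⊥ a`). -/
theorem card_filter_reflect {a b : EuclideanSpace ℝ (Fin 8)} (ha : a ∈ C) (hab : inner ℝ a b = 0)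
    (s t : ℝ) :
    (C.filter (fun y => inner ℝ a y = s ∧ inner ℝ b y = t)).card =
      (C.filter (fun y => inner ℝ a y = -s ∧ inner ℝ b y = t)).card := by
  have haa : inner ℝ a a = 1 := by rw [real_inner_self_eq_norm_sq, h1 a ha, one_pow]
  have hba : inner ℝ b a = 0 := by rw [real_inner_comm]; exact hab
  have hra : ∀ y : EuclideanSpace ℝ (Fin 8),
      inner ℝ a (y - (2 * inner ℝ a y) • a) = -inner ℝ a y := by
    intro y; rw [inner_sub_right, inner_smul_right, haa]; ring
  have hrb : ∀ y : EuclideanSpace ℝ (Fin 8),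
      inner ℝ b (y - (2 * inner ℝ a y) • a) = inner ℝ b y := by
    intro y; rw [inner_sub_right, inner_smul_right, hba, mul_zero, sub_zero]
  refine Finset.card_bij' (fun y _ => y - (2 * inner ℝ a y) • a) (fun y _ => y - (2 * inner ℝ a y) • a)
    ?_ ?_ (fun y _ => E8Closure.reflect_reflect (h1 a ha)) (fun y _ => E8Closure.reflect_reflect (h1 a ha))
  · intro y hy
    simp only [Finset.mem_filter] at hy ⊢
    exact ⟨E8Closure.reflect_mem h1 h2 hcard ha hy.1, by rw [hra, hy.2.1], by rw [hrb, hy.2.2]⟩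
  · intro y hy
    simp only [Finset.mem_filter] at hy ⊢
    exact ⟨E8Closure.reflect_mem h1 h2 hcard ha hy.1, by rw [hra, hy.2.1, neg_neg], by rw [hrb, hy.2.2]⟩

/-- **Pair count.** For orthogonal `a, b ∈ C` exactly `12` points `y ∈ C` have `⟨a,y⟩ = ⟨b,y⟩ = 1/2`
(in root normalisation: `12` roots have inner product `1` with both of two orthogonal roots of `E₈`).
[cite: ConwaySloane1999, Ch. 14 Thm. 5] -/
theorem card_half_half {a b : EuclideanSpace ℝ (Fin 8)} (ha : a ∈ C) (hb : b ∈ C)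
    (hab : inner ℝ a b = 0) :
    (C.filter (fun y => inner ℝ a y = 1 / 2 ∧ inner ℝ b y = 1 / 2)).card = 12 := by
  have h48 := card_filter_mul_ne_zero h1 h2 hcard ha hb hab
  rw [filter_mul_ne_zero_eq h1 h2 hcard ha hb hab] at h48
  have d1 : Disjoint (C.filter (fun y => inner ℝ a y = 1 / 2 ∧ inner ℝ b y = 1 / 2))
      (C.filter (fun y => inner ℝ a y = 1 / 2 ∧ inner ℝ b y = -1 / 2)) :=
    Finset.disjoint_filter.2 fun y _ hy hy' => by rw [hy.2] at hy'; norm_num at hy'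
  have d2 : Disjoint (C.filter (fun y => inner ℝ a y = 1 / 2 ∧ inner ℝ b y = 1 / 2) ∪
      C.filter (fun y => inner ℝ a y = 1 / 2 ∧ inner ℝ b y = -1 / 2))
      (C.filter (fun y => inner ℝ a y = -1 / 2 ∧ inner ℝ b y = 1 / 2)) := by
    rw [Finset.disjoint_union_left]
    exact ⟨Finset.disjoint_filter.2 fun y _ hy hy' => by rw [hy.1] at hy'; norm_num at hy',
      Finset.disjoint_filter.2 fun y _ hy hy' => by rw [hy.1] at hy'; norm_num at hy'⟩
  have d3 : Disjoint (C.filter (fun y => inner ℝ a y = 1 / 2 ∧ inner ℝ b y = 1 / 2) ∪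
      C.filter (fun y => inner ℝ a y = 1 / 2 ∧ inner ℝ b y = -1 / 2) ∪
      C.filter (fun y => inner ℝ a y = -1 / 2 ∧ inner ℝ b y = 1 / 2))
      (C.filter (fun y => inner ℝ a y = -1 / 2 ∧ inner ℝ b y = -1 / 2)) := by
    rw [Finset.disjoint_union_left, Finset.disjoint_union_left]
    exact ⟨⟨Finset.disjoint_filter.2 fun y _ hy hy' => by rw [hy.1] at hy'; norm_num at hy',
      Finset.disjoint_filter.2 fun y _ hy hy' => by rw [hy.1] at hy'; norm_num at hy'⟩,
      Finset.disjoint_filter.2 fun y _ hy hy' => by rw [hy.2] at hy'; norm_num at hy'⟩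
  rw [Finset.card_union_of_disjoint d3, Finset.card_union_of_disjoint d2,
    Finset.card_union_of_disjoint d1] at h48
  have e1 := card_filter_neg h1 h2 hcard (a := a) (b := b) (1 / 2) (1 / 2)
  have e2 := card_filter_reflect h1 h2 hcard ha hab (1 / 2) (1 / 2)
  have e3 := card_filter_reflect h1 h2 hcard ha hab (1 / 2) (-1 / 2)
  norm_num at e1 e2 e3 h48
  omega

/-- **Triple existence.** For pairwise orthogonal `a, b, c ∈ C` some `y ∈ C` has
`⟨a,y⟩, ⟨b,y⟩, ⟨c,y⟩ ∈ {±1/2}`. -/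
theorem exists_abs_half3 {a b c : EuclideanSpace ℝ (Fin 8)} (ha : a ∈ C) (hb : b ∈ C) (hc : c ∈ C)
    (hab : inner ℝ a b = 0) (hac : inner ℝ a c = 0) (hbc : inner ℝ b c = 0) :
    ∃ y ∈ C, (inner ℝ a y = 1 / 2 ∨ inner ℝ a y = -1 / 2) ∧ (inner ℝ b y = 1 / 2 ∨ inner ℝ b y = -1 / 2) ∧
      (inner ℝ c y = 1 / 2 ∨ inner ℝ c y = -1 / 2) := by
  have hS := E8Moments.sum_sq_mul_sq_mul_sq h1 h2 hcard (h1 a ha) (h1 b hb) (h1 c hc) hab hac hbc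
  have hba : inner ℝ b a = 0 := by rw [real_inner_comm]; exact hab
  have hca : inner ℝ c a = 0 := by rw [real_inner_comm]; exact hac
  by_contra hne
  push Not at hne
  have h0 : ∀ y ∈ C, inner ℝ a y ^ 2 * inner ℝ b y ^ 2 * inner ℝ c y ^ 2 = 0 := by
    intro y hy
    by_cases hay : inner ℝ a y = 0
    · rw [hay]; ring
    by_cases hby : inner ℝ b y = 0
    · rw [hby]; ring
    by_cases hcy : inner ℝ c y = 0
    · rw [hcy]; ring
    exfalso
    have qa := inner_eq_half_or h1 h2 hcard ha hab hy hay hby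
    have qb := inner_eq_half_or h1 h2 hcard hb hba hy hby hay
    have qc := inner_eq_half_or h1 h2 hcard hc hca hy hcy hay
    rcases qc with qc | qc
    · exact absurd qc (hne y hy qa qb).1
    · exact absurd qc (hne y hy qa qb).2
  rw [Finset.sum_congr rfl h0, Finset.sum_const_zero] at hS
  norm_num at hS

/-- **Triple existence, normalised signs.** For pairwise orthogonal `a, b, c ∈ C` there are an orthonormal
triple `a', b', c' ∈ C` (each `= ±` the given one) and `y ∈ C` with `⟨a',y⟩ = ⟨b',y⟩ = ⟨c',y⟩ = 1/2`.
[cite: ConwaySloane1999, Ch. 14 Thm. 5] -/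
theorem exists_triple_half {a b c : EuclideanSpace ℝ (Fin 8)} (ha : a ∈ C) (hb : b ∈ C) (hc : c ∈ C)
    (hab : inner ℝ a b = 0) (hac : inner ℝ a c = 0) (hbc : inner ℝ b c = 0) :
    ∃ a' ∈ C, ∃ b' ∈ C, ∃ c' ∈ C, ∃ y ∈ C,
      inner ℝ a' b' = 0 ∧ inner ℝ a' c' = 0 ∧ inner ℝ b' c' = 0 ∧
      inner ℝ a' y = 1 / 2 ∧ inner ℝ b' y = 1 / 2 ∧ inner ℝ c' y = 1 / 2 := by
  obtain ⟨y, hy, qa, qb, qc⟩ := exists_abs_half3 h1 h2 hcard ha hb hc hab hac hbc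
  -- sign-corrected vectors
  obtain ⟨a', ha', haa', hay⟩ : ∃ a' ∈ C, (a' = a ∨ a' = -a) ∧ inner ℝ a' y = 1 / 2 := by
    rcases qa with q | q
    · exact ⟨a, ha, Or.inl rfl, q⟩
    · exact ⟨-a, E8Closure.neg_mem h1 h2 hcard ha, Or.inr rfl, by rw [inner_neg_left, q]; norm_num⟩
  obtain ⟨b', hb', hbb', hby⟩ : ∃ b' ∈ C, (b' = b ∨ b' = -b) ∧ inner ℝ b' y = 1 / 2 := by
    rcases qb with q | q
    · exact ⟨b, hb, Or.inl rfl, q⟩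
    · exact ⟨-b, E8Closure.neg_mem h1 h2 hcard hb, Or.inr rfl, by rw [inner_neg_left, q]; norm_num⟩
  obtain ⟨c', hc', hcc', hcy⟩ : ∃ c' ∈ C, (c' = c ∨ c' = -c) ∧ inner ℝ c' y = 1 / 2 := by
    rcases qc with q | q
    · exact ⟨c, hc, Or.inl rfl, q⟩
    · exact ⟨-c, E8Closure.neg_mem h1 h2 hcard hc, Or.inr rfl, by rw [inner_neg_left, q]; norm_num⟩
  refine ⟨a', ha', b', hb', c', hc', y, hy, ?_, ?_, ?_, hay, hby, hcy⟩
  · rcases haa' with rfl | rfl <;> rcases hbb' with rfl | rfl <;>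
      simp [inner_neg_left, inner_neg_right, hab]
  · rcases haa' with rfl | rfl <;> rcases hcc' with rfl | rfl <;>
      simp [inner_neg_left, inner_neg_right, hac]
  · rcases hbb' with rfl | rfl <;> rcases hcc' with rfl | rfl <;>
      simp [inner_neg_left, inner_neg_right, hbc]

end config

end Summit.Ventures.PackingBounds.Config.E8PairCounts
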